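import Literature.Analysis.FluidPDE.SereginSverakMeridionalTypeIHolds
import Literature.Analysis.FluidPDE.SereginZajaczkowski2007SwirlPressure
import Literature.Analysis.FluidPDE.Seregin2020SingularSetAxis
import HarnessLib

/-!
# Seregin–Šverák 2009, Theorem 1.1 (rate on the meridional part): the associated pressure may be
# taken axially symmetric — discharge of `MeridionalTypeIRegularity`

Analysis/FluidPDE proofs file (theorems only: no definitions, no named facts). It DISCHARGES the
named fact `Literature.Analysis.FluidPDE.SereginSverak2009.MeridionalTypeIRegularity`
(`SereginSverakMeridionalTypeI.lean`; G. Seregin, V. Šverák, *On Type I singularities of the local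
axi-symmetric solutions of the Navier–Stokes equations*, Comm. PDE 34 (2009) 171–201 =
arXiv:0804.1803, Thm 1.1 (p. 3) with the rate (1.1) (p. 2) on the meridional part `v̄` only):
`theorem MeridionalTypeIRegularity_holds : MeridionalTypeIRegularity`.

The gap it closes. Theorem 1.1 is stated for "an axially symmetric weak solution `v` … such that
there exists an associated pressure field `q ∈ L_{3/2}(Q(z₀, R))`" (p. 3) — the tree's class
`IsAxisymmetricLocalSolution u p` records the symmetry of `v` only — while the proof of §3 is
written on the canonical domain for "`v ∈ L₃(Q)` and `q ∈ L_{3/2}(Q)` are an axially symmetric weak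
solution" (Thm 3.1, p. 9), which is the form proved in the tree
(`isRegularAtOrigin_of_meridionalTypeI`, `SereginSverakMeridionalTypeIHolds.lean`, hypothesis
`IsAxisymmetricScalar (p t)`; the symmetry of `q` enters through Lemma 3.3 = Seregin 2020 (2.6),
`Seregin2020.swirl_ae_bounded_half`). The reduction of the former to the latter is by averaging the
pressure about the axis: `q̄(t, x) = (2π)⁻¹ ∫₀^{2π} q(t, R_θ x) dθ` is axially symmetric
(`isAxisymmetricScalar_rotAverage`), lies in `L¹_loc(Q) ∩ L_{3/2}(Q)`
(`locallyIntegrableOn_rotAverage`, `lintegral_rotAverage_rpow_lt_top`: the family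
`(θ, z) ↦ (t, R_θ x)` does not charge null sets of `Q`; Fubini over the compact rotation hull of a
compact `K ⊆ Q`; Hölder in `θ` and Tonelli with the invariance of `∫∫_Q |q|^{3/2}` under each
rotation), and is again an associated pressure field of `v`: `∫∫_Q q̄ div ψ = ∫∫_Q q div ψ` for every
test field `ψ` on `Q` (`setIntegral_rotAverage_mul_divergence`), because each rotated pressure
`q(t, R_θ x)` pairs with `div ψ` like `q` itself — the rotation covariance of the weak formulation
for an axially symmetric velocity, in the tree as
`SereginZajaczkowski2007.setIntegral_pressure_mul_divergence_stRot`
(`SereginZajaczkowski2007SwirlPressure.lean`) — followed by Fubini. Hence `(v, q̄)` is in the class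
of Theorem 3.1 (`isAxisymmetricLocalSolution_rotAverage`) and the printed theorem applies
(`MeridionalTypeIRegularity_holds`).

## References

* G. Seregin, V. Šverák, Comm. Partial Differential Equations 34 (2009) 171–201 =
  arXiv:0804.1803: Thm 1.1 (p. 3), (1.1) (p. 2); §3 Thm 3.1, Lemma 3.3, Remark 3.4, Lemma 3.5,
  Prop. 3.7 (p. 9 ff.); §4. [`SereginSverak2009`]
* G. Seregin, W. Zajaczkowski, SIAM J. Math. Anal. 39 (2007) 669–685 = arXiv:math/0702720, §1
  (standing symmetry convention "`p` independent of the polar angle"). [`SereginZajaczkowski2007`]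
* G. Seregin, Anal. Math. Phys. 10 (2020) Paper 46 = arXiv:2006.04140, proof of Thm 2.1, (2.6).
  [`Seregin2020`]
-/

noncomputable section

open MeasureTheory Set Function Filter Topology TopologicalSpace Metric
open scoped NNReal ENNReal RealInnerProductSpace InnerProductSpace ContDiff Laplacian

namespace Literature.Analysis.FluidPDE

namespace SereginSverak2009

open Seregin2020 SereginZajaczkowski2007

/-! ### The azimuthal average is axially symmetric -/

/-- **Rotation averages are axially symmetric**: `x ↦ (2π)⁻¹ ∫₀^{2π} f(R_θ x) dθ` is invariant
under the rotations `R_φ` about the axis (`R_θ R_φ = R_{θ+φ}` and `2π`-periodicity of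
`θ ↦ f(R_θ x)`). [cite: SereginSverak2009, §3 p. 9 (Thm 3.1: "v and q are an axially symmetric weak solution"; the symmetric pressure is produced here by azimuthal averaging)] -/
theorem isAxisymmetricScalar_rotAverage (f : EuclideanSpace ℝ (Fin 3) → ℝ) :
    IsAxisymmetricScalar fun x => (2 * Real.pi)⁻¹ * ∫ θ in (0 : ℝ)..2 * Real.pi, f (rotZ θ x) := by
  intro φ x
  beta_reduce
  congr 1
  have hper : Function.Periodic (fun θ => f (rotZ θ x)) (2 * Real.pi) := fun θ => by
    show f (rotZ (θ + 2 * Real.pi) x) = f (rotZ θ x)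
    rw [rotZ_add, rotZ_two_pi]
  calc ∫ θ in (0 : ℝ)..2 * Real.pi, f (rotZ θ (rotZ φ x))
      = ∫ θ in (0 : ℝ)..2 * Real.pi, f (rotZ (θ + φ) x) := by simp_rw [rotZ_add]
    _ = ∫ θ in (0 : ℝ) + φ..2 * Real.pi + φ, f (rotZ θ x) :=
        intervalIntegral.integral_comp_add_right (fun θ => f (rotZ θ x)) φ
    _ = ∫ θ in φ..φ + 2 * Real.pi, f (rotZ θ x) := by rw [zero_add, add_comm]
    _ = ∫ θ in (0 : ℝ)..0 + 2 * Real.pi, f (rotZ θ x) := hper.intervalIntegral_add_eq φ 0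
    _ = ∫ θ in (0 : ℝ)..2 * Real.pi, f (rotZ θ x) := by rw [zero_add]

/-! ### Measure theory of the family of space–time rotations on `Q` -/

/-- **The family of space–time rotations does not charge null sets of `Q`**: for `B ⊆ Q`, the
push-forward of `dθ|_{]0,2π]} ⊗ dz|_B` under `(θ, z) ↦ (t, R_θ x)` is absolutely continuous with
respect to Lebesgue measure on `Q` (each `stRot θ` preserves the measure and `Q`), so that
`(θ, z) ↦ q(t, R_θ x)` is a.e. strongly measurable for `q` measurable on `Q`.
[cite: SereginSverak2009, §3 p. 9 (Q = 𝒞 × ]-1, 0[, axial symmetry about the x₃-axis)] -/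
theorem quasiMeasurePreserving_stRot_prod {B : Set (ℝ × EuclideanSpace ℝ (Fin 3))}
    (hBS : B ⊆ parCyl 0 1) :
    Measure.QuasiMeasurePreserving
      (fun q : ℝ × (ℝ × EuclideanSpace ℝ (Fin 3)) => stRot q.1 q.2)
      ((volume.restrict (Ioc (0 : ℝ) (2 * Real.pi))).prod (volume.restrict B))
      (volume.restrict (parCyl 0 1)) := by
  have hg : Measurable (fun q : ℝ × (ℝ × EuclideanSpace ℝ (Fin 3)) => stRot q.1 q.2) :=
    continuous_stRot_prod.measurable
  refine ⟨hg, Measure.AbsolutelyContinuous.mk fun A hA hA0 => ?_⟩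
  rw [Measure.map_apply hg hA, Measure.prod_apply (hg hA)]
  have hA0' : volume (A ∩ parCyl 0 1) = 0 := by rwa [Measure.restrict_apply hA] at hA0
  have hzero : ∀ θ : ℝ, volume.restrict B
      (Prod.mk θ ⁻¹' ((fun q : ℝ × (ℝ × EuclideanSpace ℝ (Fin 3)) => stRot q.1 q.2) ⁻¹' A)) = 0 := by
    intro θ
    rw [Measure.restrict_apply (measurable_prodMk_left (hg hA))]
    have hsub : Prod.mk θ ⁻¹' ((fun q : ℝ × (ℝ × EuclideanSpace ℝ (Fin 3)) => stRot q.1 q.2) ⁻¹' A)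
        ∩ B ⊆ stRot θ ⁻¹' (A ∩ parCyl 0 1) := by
      rintro z ⟨hzA, hzB⟩
      exact ⟨hzA, (mem_parCyl_zero_one_rotZ_iff θ z).2 (hBS hzB)⟩
    refine measure_mono_null hsub ?_
    rw [(measurePreserving_stRot θ).measure_preimage
      (hA.inter (isOpen_parCyl 0 1).measurableSet).nullMeasurableSet]
    exact hA0'
  simp_rw [hzero]
  rw [lintegral_zero]

/-- **Integrability of the rotated pressures over a compact part of `Q`.** If `q` is locally
integrable on `Q` and `K ⊆ Q` is compact, then `(θ, (t, x)) ↦ q(t, R_θ x)` is integrable on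
`]0, 2π] × K`: all rotated copies of `K` lie in the compact rotation hull of `K` inside `Q`, on
which `q` is integrable. [cite: SereginSverak2009, §3 p. 9 (q ∈ L_{3/2}(Q); the axially symmetric pair of Thm 3.1)] -/
theorem integrable_pressure_stRot_prod {p : ℝ → EuclideanSpace ℝ (Fin 3) → ℝ}
    (hp : LocallyIntegrableOn (uncurry p) (parCyl 0 1) volume)
    {K : Set (ℝ × EuclideanSpace ℝ (Fin 3))} (hK : IsCompact K) (hKS : K ⊆ parCyl 0 1) :
    Integrable (fun q : ℝ × (ℝ × EuclideanSpace ℝ (Fin 3)) => uncurry p (stRot q.1 q.2))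
      ((volume.restrict (Ioc (0 : ℝ) (2 * Real.pi))).prod (volume.restrict K)) := by
  -- the rotation hull of `K`
  set H : Set (ℝ × EuclideanSpace ℝ (Fin 3)) :=
    (fun q : ℝ × (ℝ × EuclideanSpace ℝ (Fin 3)) => stRot q.1 q.2) '' (Icc (0 : ℝ) (2 * Real.pi) ×ˢ K)
    with hH
  have hHc : IsCompact H := (isCompact_Icc.prod hK).image continuous_stRot_prod
  have hHS : H ⊆ parCyl 0 1 := by
    rintro _ ⟨⟨θ, z⟩, ⟨-, hz⟩, rfl⟩
    exact (mem_parCyl_zero_one_rotZ_iff θ z).2 (hKS hz)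
  have hpH : IntegrableOn (uncurry p) H volume := hp.integrableOn_compact_subset hHS hHc
  have himK : ∀ θ ∈ Icc (0 : ℝ) (2 * Real.pi), stRot θ '' K ⊆ H := by
    rintro θ hθ _ ⟨z, hz, rfl⟩
    exact ⟨(θ, z), ⟨hθ, hz⟩, rfl⟩
  -- measurability
  have hmeas : AEStronglyMeasurable
      (fun q : ℝ × (ℝ × EuclideanSpace ℝ (Fin 3)) => uncurry p (stRot q.1 q.2))
      ((volume.restrict (Ioc (0 : ℝ) (2 * Real.pi))).prod (volume.restrict K)) :=
    hp.aestronglyMeasurable.comp_quasiMeasurePreserving (quasiMeasurePreserving_stRot_prod hKS)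
  rw [integrable_prod_iff hmeas]
  constructor
  · -- the slices `z ↦ q(stRot θ z)` are integrable on `K`
    refine (ae_restrict_iff' measurableSet_Ioc).2 (Eventually.of_forall fun θ hθ => ?_)
    have h1 : IntegrableOn (uncurry p) (stRot θ '' K) volume :=
      hpH.mono_set (himK θ (Ioc_subset_Icc_self hθ))
    exact ((measurePreserving_stRot θ).integrableOn_image (measurableEmbedding_stRot θ)).1 h1
  · -- the slice integrals of `|q|` are bounded by `∫_H |q|`
    have hbound : ∀ θ ∈ Ioc (0 : ℝ) (2 * Real.pi),
        ∫ z, ‖uncurry p (stRot θ z)‖ ∂(volume.restrict K) ≤ ∫ w in H, ‖uncurry p w‖ := by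
      intro θ hθ
      rw [← (measurePreserving_stRot θ).setIntegral_image_emb (measurableEmbedding_stRot θ)
        (fun w => ‖uncurry p w‖) K]
      exact setIntegral_mono_set hpH.norm (Eventually.of_forall fun _ => norm_nonneg _)
        (Eventually.of_forall (himK θ (Ioc_subset_Icc_self hθ)))
    have hconst : Integrable (fun _ : ℝ => ∫ w in H, ‖uncurry p w‖)
        (volume.restrict (Ioc (0 : ℝ) (2 * Real.pi))) :=
      integrableOn_const measure_Ioc_lt_top.ne
    refine hconst.mono' hmeas.norm.integral_prod_right' ?_
    refine (ae_restrict_iff' measurableSet_Ioc).2 (Eventually.of_forall fun θ hθ => ?_)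
    rw [Real.norm_eq_abs, abs_of_nonneg (integral_nonneg fun _ => norm_nonneg _)]
    exact hbound θ hθ

/-! ### The azimuthal average of the pressure: `L¹_loc(Q)` and `L_{3/2}(Q)` -/

/-- The azimuthal average of a pressure locally integrable on `Q` is integrable on each compact
`K ⊆ Q` (Fubini over the rotation family). [cite: SereginSverak2009, §3 p. 9 (q ∈ L_{3/2}(Q); the axially symmetric pair of Thm 3.1)] -/
theorem integrableOn_rotAverage {p : ℝ → EuclideanSpace ℝ (Fin 3) → ℝ}
    (hp : LocallyIntegrableOn (uncurry p) (parCyl 0 1) volume)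
    {K : Set (ℝ × EuclideanSpace ℝ (Fin 3))} (hK : IsCompact K) (hKS : K ⊆ parCyl 0 1) :
    IntegrableOn (uncurry fun t x => (2 * Real.pi)⁻¹ * ∫ θ in (0 : ℝ)..2 * Real.pi, p t (rotZ θ x))
      K volume := by
  have h := (integrable_pressure_stRot_prod hp hK hKS).integral_prod_right
  have e : (uncurry fun t x => (2 * Real.pi)⁻¹ * ∫ θ in (0 : ℝ)..2 * Real.pi, p t (rotZ θ x)) =
      fun z : ℝ × EuclideanSpace ℝ (Fin 3) =>
        (2 * Real.pi)⁻¹ * ∫ θ in Ioc (0 : ℝ) (2 * Real.pi), uncurry p (stRot θ z) := by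
    funext z
    rw [← intervalIntegral.integral_of_le (by positivity)]
    rfl
  rw [IntegrableOn, e]
  exact h.const_mul _

/-- **The azimuthal average `q̄(t, x) = (2π)⁻¹ ∫₀^{2π} q(t, R_θ x) dθ` of a pressure
`q ∈ L¹_loc(Q)` is in `L¹_loc(Q)`.** [cite: SereginSverak2009, §3 p. 9 (the pressure of the axially symmetric pair of Thm 3.1)] -/
theorem locallyIntegrableOn_rotAverage {p : ℝ → EuclideanSpace ℝ (Fin 3) → ℝ}
    (hp : LocallyIntegrableOn (uncurry p) (parCyl 0 1) volume) :
    LocallyIntegrableOn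
      (uncurry fun t x => (2 * Real.pi)⁻¹ * ∫ θ in (0 : ℝ)..2 * Real.pi, p t (rotZ θ x))
      (parCyl 0 1) volume :=
  (locallyIntegrableOn_iff (isOpen_parCyl 0 1).isLocallyClosed).2 fun _ hKS hK =>
    integrableOn_rotAverage hp hK hKS

/-- Pointwise Hölder bound for the azimuthal average: `|q̄(z)|^{3/2} ≤ C ∫₀^{2π} |q(t, R_θ x)|^{3/2} dθ`
with `C = (2π)^{-3/2} (2π)^{1/2}`. [folklore] -/
private theorem enorm_rotAverage_rpow_le {p : ℝ → EuclideanSpace ℝ (Fin 3) → ℝ}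
    (z : ℝ × EuclideanSpace ℝ (Fin 3))
    (hmeas : AEStronglyMeasurable (fun θ => uncurry p (stRot θ z))
      (volume.restrict (Ioc (0 : ℝ) (2 * Real.pi)))) :
    ‖(2 * Real.pi)⁻¹ * ∫ θ in (0 : ℝ)..2 * Real.pi, p z.1 (rotZ θ z.2)‖ₑ ^ (3 / 2 : ℝ) ≤
      (‖(2 * Real.pi)⁻¹‖ₑ ^ (3 / 2 : ℝ) *
          ((volume (Ioc (0 : ℝ) (2 * Real.pi))) ^ (1 / (3 : ℝ))) ^ (3 / 2 : ℝ)) *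
        ∫⁻ θ in Ioc (0 : ℝ) (2 * Real.pi), ‖uncurry p (stRot θ z)‖ₑ ^ (3 / 2 : ℝ) := by
  have hpq : (3 / 2 : ℝ).HolderConjugate 3 := Real.holderConjugate_iff.2 ⟨by norm_num, by norm_num⟩
  rw [intervalIntegral.integral_of_le (by positivity), enorm_mul]
  have hF : AEMeasurable (fun θ => ‖uncurry p (stRot θ z)‖ₑ)
      (volume.restrict (Ioc (0 : ℝ) (2 * Real.pi))) := hmeas.enorm
  have h1 : ‖∫ θ in Ioc (0 : ℝ) (2 * Real.pi), p z.1 (rotZ θ z.2)‖ₑ ≤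
      ∫⁻ θ in Ioc (0 : ℝ) (2 * Real.pi), ‖uncurry p (stRot θ z)‖ₑ :=
    enorm_integral_le_lintegral_enorm _
  have h2 : ∫⁻ θ in Ioc (0 : ℝ) (2 * Real.pi), ‖uncurry p (stRot θ z)‖ₑ ≤
      (∫⁻ θ in Ioc (0 : ℝ) (2 * Real.pi), ‖uncurry p (stRot θ z)‖ₑ ^ (3 / 2 : ℝ)) ^ (1 / (3 / 2 : ℝ)) *
        (volume (Ioc (0 : ℝ) (2 * Real.pi))) ^ (1 / (3 : ℝ)) := by
    have := ENNReal.lintegral_mul_le_Lp_mul_Lq (volume.restrict (Ioc (0 : ℝ) (2 * Real.pi))) hpq hF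
      (aemeasurable_const (b := (1 : ℝ≥0∞)))
    simpa only [Pi.mul_apply, mul_one, ENNReal.one_rpow, lintegral_const, one_mul,
      Measure.restrict_apply_univ] using this
  calc (‖(2 * Real.pi)⁻¹‖ₑ * ‖∫ θ in Ioc (0 : ℝ) (2 * Real.pi), p z.1 (rotZ θ z.2)‖ₑ) ^ (3 / 2 : ℝ)
      ≤ (‖(2 * Real.pi)⁻¹‖ₑ *
          ((∫⁻ θ in Ioc (0 : ℝ) (2 * Real.pi), ‖uncurry p (stRot θ z)‖ₑ ^ (3 / 2 : ℝ)) ^ (1 / (3 / 2 : ℝ)) *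
            (volume (Ioc (0 : ℝ) (2 * Real.pi))) ^ (1 / (3 : ℝ)))) ^ (3 / 2 : ℝ) := by
        gcongr
        exact h1.trans h2
    _ = _ := by
        rw [ENNReal.mul_rpow_of_nonneg _ _ (by norm_num : (0 : ℝ) ≤ 3 / 2),
          ENNReal.mul_rpow_of_nonneg _ _ (by norm_num : (0 : ℝ) ≤ 3 / 2), ← ENNReal.rpow_mul,
          (by norm_num : (1 / (3 / 2 : ℝ)) * (3 / 2) = 1), ENNReal.rpow_one]
        ring

/-- **The azimuthal average of a pressure `q ∈ L_{3/2}(Q)` is in `L_{3/2}(Q)`**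
(Hölder in `θ`, Tonelli, and invariance of `∫∫_Q |q|^{3/2}` under the rotations `stRot θ`).
[cite: SereginSverak2009, §3 p. 9 (q ∈ L_{3/2}(Q) for the axially symmetric pair of Thm 3.1)] -/
theorem lintegral_rotAverage_rpow_lt_top {p : ℝ → EuclideanSpace ℝ (Fin 3) → ℝ}
    (hp : LocallyIntegrableOn (uncurry p) (parCyl 0 1) volume)
    (hp32 : ∫⁻ z in parCyl 0 1, ‖p z.1 z.2‖ₑ ^ (3 / 2 : ℝ) < ⊤) :
    ∫⁻ z in parCyl 0 1,
        ‖(2 * Real.pi)⁻¹ * ∫ θ in (0 : ℝ)..2 * Real.pi, p z.1 (rotZ θ z.2)‖ₑ ^ (3 / 2 : ℝ) < ⊤ := by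
  set C : ℝ≥0∞ := ‖(2 * Real.pi)⁻¹‖ₑ ^ (3 / 2 : ℝ) *
    ((volume (Ioc (0 : ℝ) (2 * Real.pi))) ^ (1 / (3 : ℝ))) ^ (3 / 2 : ℝ) with hC
  have hCtop : C ≠ ⊤ := by
    refine ENNReal.mul_ne_top ?_ ?_
    · exact (ENNReal.rpow_lt_top_of_nonneg (by norm_num : (0 : ℝ) ≤ 3 / 2) enorm_ne_top).ne
    · exact (ENNReal.rpow_lt_top_of_nonneg (by norm_num : (0 : ℝ) ≤ 3 / 2)
        (ENNReal.rpow_lt_top_of_nonneg (by norm_num : (0 : ℝ) ≤ 1 / 3) measure_Ioc_lt_top.ne).ne).ne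
  have hQ : ∀ θ : ℝ, ∀ z ∈ parCyl 0 1, stRot θ z ∈ parCyl 0 1 :=
    fun θ z hz => (mem_parCyl_zero_one_rotZ_iff θ z).2 hz
  have hPmeas : AEStronglyMeasurable
      (fun q : ℝ × (ℝ × EuclideanSpace ℝ (Fin 3)) => uncurry p (stRot q.1 q.2))
      ((volume.restrict (Ioc (0 : ℝ) (2 * Real.pi))).prod (volume.restrict (parCyl 0 1))) :=
    hp.aestronglyMeasurable.comp_quasiMeasurePreserving (quasiMeasurePreserving_stRot_prod subset_rfl)
  have hPswap : AEStronglyMeasurable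
      (fun q : (ℝ × EuclideanSpace ℝ (Fin 3)) × ℝ => uncurry p (stRot q.2 q.1))
      ((volume.restrict (parCyl 0 1)).prod (volume.restrict (Ioc (0 : ℝ) (2 * Real.pi)))) :=
    hPmeas.comp_measurePreserving Measure.measurePreserving_swap
  have hsec : ∀ᵐ z ∂(volume.restrict (parCyl 0 1)),
      AEStronglyMeasurable (fun θ => uncurry p (stRot θ z))
        (volume.restrict (Ioc (0 : ℝ) (2 * Real.pi))) :=
    hPswap.prodMk_left
  have hinv : ∀ θ : ℝ, ∫⁻ z in parCyl 0 1, ‖uncurry p (stRot θ z)‖ₑ ^ (3 / 2 : ℝ) =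
      ∫⁻ z in parCyl 0 1, ‖p z.1 z.2‖ₑ ^ (3 / 2 : ℝ) := by
    intro θ
    have h := (measurePreserving_stRot θ).setLIntegral_comp_preimage_emb (measurableEmbedding_stRot θ)
      (fun w => ‖uncurry p w‖ₑ ^ (3 / 2 : ℝ)) (parCyl 0 1)
    rw [preimage_stRot_eq hQ θ] at h
    exact h
  calc ∫⁻ z in parCyl 0 1,
        ‖(2 * Real.pi)⁻¹ * ∫ θ in (0 : ℝ)..2 * Real.pi, p z.1 (rotZ θ z.2)‖ₑ ^ (3 / 2 : ℝ)
      ≤ ∫⁻ z in parCyl 0 1,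
          C * ∫⁻ θ in Ioc (0 : ℝ) (2 * Real.pi), ‖uncurry p (stRot θ z)‖ₑ ^ (3 / 2 : ℝ) :=
        lintegral_mono_ae (hsec.mono fun z hz => enorm_rotAverage_rpow_le z hz)
    _ = C * ∫⁻ z in parCyl 0 1,
          ∫⁻ θ in Ioc (0 : ℝ) (2 * Real.pi), ‖uncurry p (stRot θ z)‖ₑ ^ (3 / 2 : ℝ) :=
        lintegral_const_mul' _ _ hCtop
    _ = C * ∫⁻ θ in Ioc (0 : ℝ) (2 * Real.pi),
          ∫⁻ z in parCyl 0 1, ‖uncurry p (stRot θ z)‖ₑ ^ (3 / 2 : ℝ) := by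
        rw [lintegral_lintegral_swap
          (f := fun (z : ℝ × EuclideanSpace ℝ (Fin 3)) (θ : ℝ) =>
            ‖uncurry p (stRot θ z)‖ₑ ^ (3 / 2 : ℝ))
          (hPswap.aemeasurable.enorm.pow_const _)]
    _ = C * ∫⁻ _ in Ioc (0 : ℝ) (2 * Real.pi), ∫⁻ z in parCyl 0 1, ‖p z.1 z.2‖ₑ ^ (3 / 2 : ℝ) := by
        simp_rw [hinv]
    _ = C * ((∫⁻ z in parCyl 0 1, ‖p z.1 z.2‖ₑ ^ (3 / 2 : ℝ)) * volume (Ioc (0 : ℝ) (2 * Real.pi))) := by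
        rw [lintegral_const, Measure.restrict_apply_univ]
    _ < ⊤ := ENNReal.mul_lt_top hCtop.lt_top (ENNReal.mul_lt_top hp32 measure_Ioc_lt_top)

/-! ### The azimuthal average of the pressure is again a pressure -/

/-- The azimuthal average of the pressure pairs integrably with `div ψ` on `Q` for every test field
`ψ` on `Q` (`q̄ ∈ L¹_loc(Q)`, `div ψ` bounded and compactly supported in `Q`). [folklore] -/
private theorem integrableOn_rotAverage_mul_divergence {p : ℝ → EuclideanSpace ℝ (Fin 3) → ℝ}
    (hp : LocallyIntegrableOn (uncurry p) (parCyl 0 1) volume)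
    {ψ : ℝ → EuclideanSpace ℝ (Fin 3) → EuclideanSpace ℝ (Fin 3)}
    (hψ : IsSpaceTimeTestOn (parCylOpens 0 1) ψ) :
    IntegrableOn (fun z : ℝ × EuclideanSpace ℝ (Fin 3) =>
        ((2 * Real.pi)⁻¹ * ∫ θ in (0 : ℝ)..2 * Real.pi, p z.1 (rotZ θ z.2)) *
          VectorCalculus.divergence (ψ z.1) z.2) (parCyl 0 1) volume := by
  have hK : IsCompact (tsupport (uncurry ψ)) := hψ.hasCompactSupport
  have hKS : tsupport (uncurry ψ) ⊆ parCyl 0 1 := hψ.tsupport_subset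
  have hdc : Continuous fun z : ℝ × EuclideanSpace ℝ (Fin 3) =>
      VectorCalculus.divergence (ψ z.1) z.2 := hψ.continuous_divergence_slice
  have hd0 : ∀ z : ℝ × EuclideanSpace ℝ (Fin 3), z ∉ tsupport (uncurry ψ) →
      VectorCalculus.divergence (ψ z.1) z.2 = 0 :=
    fun z hz => divergence_eq_zero_of_notMem_tsupport (notMem_tsupport_slice_of_notMem hz)
  obtain ⟨M, -, hM⟩ := exists_norm_le_of_hasCompactSupport hdc (HasCompactSupport.intro hK hd0)
  have hpbar := locallyIntegrableOn_rotAverage hp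
  refine integrableOn_of_norm_le_of_eq_zero (Q := parCylOpens 0 1) hpbar
    (hpbar.aestronglyMeasurable.mul hdc.aestronglyMeasurable) hK hKS (M := M) (fun z => ?_)
    (fun z hz => ?_)
  · rw [norm_mul, mul_comm]
    exact mul_le_mul_of_nonneg_right (hM z) (norm_nonneg _)
  · rw [hd0 z hz, mul_zero]

/-- **The averaged pressure pairs with `div ψ` exactly like the pressure**: for a distributional
solution `(v, q)` (`f = 0`) in `Q` with axially symmetric velocity slices and a test field `ψ` on
`Q`, `∫∫_Q q̄ div ψ = ∫∫_Q q div ψ`. Each rotated pressure `q(t, R_θ x)` pairs with `div ψ` like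
`q` itself (`SereginZajaczkowski2007.setIntegral_pressure_mul_divergence_stRot`: the momentum
equation tested with `ψ` and with its conjugate `R_θ⁻¹ψ(t, R_θ x)`, covariance of the velocity terms
under the symmetry of `v`, and the change of variables `x ↦ R_θ x`); then Fubini over
`θ ∈ ]0, 2π]`. [cite: SereginSverak2009, Thm 1.1 (arXiv p. 3: "an associated pressure field q") and Thm 3.1 (p. 9: "v and q are an axially symmetric weak solution")] -/
theorem setIntegral_rotAverage_mul_divergence
    {u : ℝ → EuclideanSpace ℝ (Fin 3) → EuclideanSpace ℝ (Fin 3)}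
    {p : ℝ → EuclideanSpace ℝ (Fin 3) → ℝ} {ν : ℝ}
    (hd : IsDistributionalNSSolutionOn (parCylOpens 0 1) ν 0 u p)
    (hax : ∀ t ∈ Ioo (-1 : ℝ) 0, IsAxisymmetric (u t))
    {ψ : ℝ → EuclideanSpace ℝ (Fin 3) → EuclideanSpace ℝ (Fin 3)}
    (hψ : IsSpaceTimeTestOn (parCylOpens 0 1) ψ) :
    ∫ z in parCyl 0 1, ((2 * Real.pi)⁻¹ * ∫ θ in (0 : ℝ)..2 * Real.pi, p z.1 (rotZ θ z.2)) *
        VectorCalculus.divergence (ψ z.1) z.2 =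
      ∫ z in parCyl 0 1, p z.1 z.2 * VectorCalculus.divergence (ψ z.1) z.2 := by
  have hQ : ∀ θ : ℝ, ∀ z ∈ (parCylOpens 0 1 : Set (ℝ × EuclideanSpace ℝ (Fin 3))),
      stRot θ z ∈ (parCylOpens 0 1 : Set (ℝ × EuclideanSpace ℝ (Fin 3))) :=
    fun θ z hz => (mem_parCyl_zero_one_rotZ_iff θ z).2 hz
  have hV : IsAxisymmetricOn (parCylOpens 0 1 : Set (ℝ × EuclideanSpace ℝ (Fin 3))) u :=
    isAxisymmetricOn_of_isAxisymmetric hax fun z hz => by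
      have h := (mem_parCyl_zero.1 hz).1
      rwa [one_pow] at h
  -- (i) every rotated pressure pairs with `div ψ` like `p` itself
  have hrot : ∀ θ : ℝ,
      ∫ z in parCyl 0 1, p z.1 (rotZ θ z.2) * VectorCalculus.divergence (ψ z.1) z.2 =
        ∫ z in parCyl 0 1, p z.1 z.2 * VectorCalculus.divergence (ψ z.1) z.2 := by
    intro θ
    have h := setIntegral_pressure_mul_divergence_stRot hQ hd hV hψ (-θ)
    have hcv := (measurePreserving_stRot θ).setIntegral_preimage_emb (measurableEmbedding_stRot θ)
      (fun w : ℝ × EuclideanSpace ℝ (Fin 3) =>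
        p w.1 w.2 * VectorCalculus.divergence (ψ w.1) (rotZ (-θ) w.2)) (parCyl 0 1)
    rw [preimage_stRot_eq (fun θ z hz => (mem_parCyl_zero_one_rotZ_iff θ z).2 hz) θ] at hcv
    simp only [stRot_fst, stRot_snd, ← rotZ_add, neg_add_cancel, rotZ_zero] at hcv
    rw [hcv]
    simpa only [coe_parCylOpens] using h
  -- (ii) joint integrability of `q(t, R_θ x) div ψ(t, x)` on `]0, 2π] × Q`
  have hK : IsCompact (tsupport (uncurry ψ)) := hψ.hasCompactSupport
  have hKS : tsupport (uncurry ψ) ⊆ parCyl 0 1 := hψ.tsupport_subset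
  have hdc : Continuous fun z : ℝ × EuclideanSpace ℝ (Fin 3) =>
      VectorCalculus.divergence (ψ z.1) z.2 := hψ.continuous_divergence_slice
  have hd0 : ∀ z : ℝ × EuclideanSpace ℝ (Fin 3), z ∉ tsupport (uncurry ψ) →
      VectorCalculus.divergence (ψ z.1) z.2 = 0 :=
    fun z hz => divergence_eq_zero_of_notMem_tsupport (notMem_tsupport_slice_of_notMem hz)
  obtain ⟨M, -, hM⟩ := exists_norm_le_of_hasCompactSupport hdc (HasCompactSupport.intro hK hd0)
  have hprod : Integrable
      (uncurry fun (θ : ℝ) (z : ℝ × EuclideanSpace ℝ (Fin 3)) =>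
        p z.1 (rotZ θ z.2) * VectorCalculus.divergence (ψ z.1) z.2)
      ((volume.restrict (Ioc (0 : ℝ) (2 * Real.pi))).prod (volume.restrict (parCyl 0 1))) := by
    have hPK := integrable_pressure_stRot_prod hd.2.2.1 hK hKS
    have hFK : Integrable
        (uncurry fun (θ : ℝ) (z : ℝ × EuclideanSpace ℝ (Fin 3)) =>
          p z.1 (rotZ θ z.2) * VectorCalculus.divergence (ψ z.1) z.2)
        ((volume.restrict (Ioc (0 : ℝ) (2 * Real.pi))).prod
          (volume.restrict (tsupport (uncurry ψ)))) := by
      refine (hPK.norm.mul_const M).mono'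
        (hPK.aestronglyMeasurable.mul (hdc.comp continuous_snd).aestronglyMeasurable)
        (Eventually.of_forall fun q => ?_)
      show ‖p q.2.1 (rotZ q.1 q.2.2) * VectorCalculus.divergence (ψ q.2.1) q.2.2‖ ≤
        ‖p q.2.1 (rotZ q.1 q.2.2)‖ * M
      rw [norm_mul]
      exact mul_le_mul_of_nonneg_left (hM _) (norm_nonneg _)
    have hFK' : IntegrableOn
        (uncurry fun (θ : ℝ) (z : ℝ × EuclideanSpace ℝ (Fin 3)) =>
          p z.1 (rotZ θ z.2) * VectorCalculus.divergence (ψ z.1) z.2)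
        (Ioc (0 : ℝ) (2 * Real.pi) ×ˢ tsupport (uncurry ψ)) (volume.prod volume) := by
      rw [IntegrableOn, ← Measure.prod_restrict]
      exact hFK
    rw [Measure.prod_restrict]
    refine hFK'.of_forall_sdiff_eq_zero (measurableSet_Ioc.prod (isOpen_parCyl 0 1).measurableSet)
      fun q hq => ?_
    have hz : q.2 ∉ tsupport (uncurry ψ) := fun h => hq.2 (Set.mem_prod.2 ⟨(Set.mem_prod.1 hq.1).1, h⟩)
    show p q.2.1 (rotZ q.1 q.2.2) * VectorCalculus.divergence (ψ q.2.1) q.2.2 = 0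
    rw [hd0 q.2 hz, mul_zero]
  -- (iii) Fubini
  have h2π : (0 : ℝ) ≤ 2 * Real.pi := by positivity
  calc ∫ z in parCyl 0 1, ((2 * Real.pi)⁻¹ * ∫ θ in (0 : ℝ)..2 * Real.pi, p z.1 (rotZ θ z.2)) *
          VectorCalculus.divergence (ψ z.1) z.2
      = ∫ z in parCyl 0 1, (2 * Real.pi)⁻¹ * ∫ θ in Ioc (0 : ℝ) (2 * Real.pi),
          p z.1 (rotZ θ z.2) * VectorCalculus.divergence (ψ z.1) z.2 := by
        refine setIntegral_congr_fun (isOpen_parCyl 0 1).measurableSet fun z _ => ?_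
        rw [intervalIntegral.integral_of_le h2π, mul_assoc, ← integral_mul_const]
    _ = (2 * Real.pi)⁻¹ * ∫ z in parCyl 0 1, ∫ θ in Ioc (0 : ℝ) (2 * Real.pi),
          p z.1 (rotZ θ z.2) * VectorCalculus.divergence (ψ z.1) z.2 := integral_const_mul _ _
    _ = (2 * Real.pi)⁻¹ * ∫ θ in Ioc (0 : ℝ) (2 * Real.pi), ∫ z in parCyl 0 1,
          p z.1 (rotZ θ z.2) * VectorCalculus.divergence (ψ z.1) z.2 := by
        rw [← integral_integral_swap hprod]
    _ = (2 * Real.pi)⁻¹ * ∫ θ in Ioc (0 : ℝ) (2 * Real.pi), ∫ z in parCyl 0 1,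
          p z.1 z.2 * VectorCalculus.divergence (ψ z.1) z.2 := by simp_rw [hrot]
    _ = ∫ z in parCyl 0 1, p z.1 z.2 * VectorCalculus.divergence (ψ z.1) z.2 := by
        rw [← intervalIntegral.integral_of_le h2π, intervalIntegral.integral_const, smul_eq_mul,
          sub_zero, ← mul_assoc, inv_mul_cancel₀ (by positivity : (2 * Real.pi : ℝ) ≠ 0), one_mul]

/-- The momentum identity for the pair `(v, q̄)`. [folklore] -/
private theorem momentum_rotAverage
    {u : ℝ → EuclideanSpace ℝ (Fin 3) → EuclideanSpace ℝ (Fin 3)}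
    {p : ℝ → EuclideanSpace ℝ (Fin 3) → ℝ} {ν : ℝ}
    (hd : IsDistributionalNSSolutionOn (parCylOpens 0 1) ν 0 u p)
    (hax : ∀ t ∈ Ioo (-1 : ℝ) 0, IsAxisymmetric (u t))
    {ψ : ℝ → EuclideanSpace ℝ (Fin 3) → EuclideanSpace ℝ (Fin 3)}
    (hψ : IsSpaceTimeTestOn (parCylOpens 0 1) ψ) :
    ∫ z in parCyl 0 1, (⟪u z.1 z.2, timeDeriv ψ z.1 z.2⟫ +
        ⟪u z.1 z.2, convect (u z.1) (ψ z.1) z.2⟫ + ν * ⟪u z.1 z.2, Δ (ψ z.1) z.2⟫ +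
        ((2 * Real.pi)⁻¹ * ∫ θ in (0 : ℝ)..2 * Real.pi, p z.1 (rotZ θ z.2)) *
          VectorCalculus.divergence (ψ z.1) z.2) = 0 := by
  have hN : IntegrableOn (fun z : ℝ × EuclideanSpace ℝ (Fin 3) =>
      ⟪u z.1 z.2, timeDeriv ψ z.1 z.2⟫ + ⟪u z.1 z.2, convect (u z.1) (ψ z.1) z.2⟫ +
        ν * ⟪u z.1 z.2, Δ (ψ z.1) z.2⟫) (parCyl 0 1) volume :=
    integrableOn_nsVPart hd hψ
  have hPD : IntegrableOn (fun z : ℝ × EuclideanSpace ℝ (Fin 3) =>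
      p z.1 z.2 * VectorCalculus.divergence (ψ z.1) z.2) (parCyl 0 1) volume :=
    integrableOn_pressure_mul_divergence hd hψ
  have hPbarD := integrableOn_rotAverage_mul_divergence hd.2.2.1 hψ
  have h0 : ∫ z in parCyl 0 1, (⟪u z.1 z.2, timeDeriv ψ z.1 z.2⟫ +
      ⟪u z.1 z.2, convect (u z.1) (ψ z.1) z.2⟫ + ν * ⟪u z.1 z.2, Δ (ψ z.1) z.2⟫ +
      p z.1 z.2 * VectorCalculus.divergence (ψ z.1) z.2) = 0 := by
    have h := hd.2.2.2.2 ψ hψ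
    simpa only [Pi.zero_apply, inner_zero_left, add_zero, coe_parCylOpens] using h
  rw [integral_add hN hPbarD, setIntegral_rotAverage_mul_divergence hd hax hψ, ← integral_add hN hPD]
  exact h0

/-- **Averaging the pressure about the axis preserves distributional solutions with axially
symmetric velocity**: if `(v, q)` solves Navier–Stokes (`f = 0`) in the sense of distributions in
`Q` and the slices of `v` are axially symmetric, then so does `(v, q̄)`,
`q̄(t, x) = (2π)⁻¹ ∫₀^{2π} q(t, R_θ x) dθ` (`q̄ ∈ L¹_loc(Q)`; divergence-free condition unchanged;
momentum identity by `setIntegral_rotAverage_mul_divergence`).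
[cite: SereginSverak2009, Thm 1.1 (arXiv p. 3: "an associated pressure field q") and Thm 3.1 (p. 9: "v and q are an axially symmetric weak solution")] -/
theorem isDistributionalNSSolutionOn_rotAverage
    {u : ℝ → EuclideanSpace ℝ (Fin 3) → EuclideanSpace ℝ (Fin 3)}
    {p : ℝ → EuclideanSpace ℝ (Fin 3) → ℝ} {ν : ℝ}
    (hd : IsDistributionalNSSolutionOn (parCylOpens 0 1) ν 0 u p)
    (hax : ∀ t ∈ Ioo (-1 : ℝ) 0, IsAxisymmetric (u t)) :
    IsDistributionalNSSolutionOn (parCylOpens 0 1) ν 0 u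
      (fun t x => (2 * Real.pi)⁻¹ * ∫ θ in (0 : ℝ)..2 * Real.pi, p t (rotZ θ x)) := by
  refine ⟨hd.1, hd.2.1, locallyIntegrableOn_rotAverage hd.2.2.1, hd.2.2.2.1, fun ψ hψ => ?_⟩
  have h := momentum_rotAverage hd hax hψ
  simpa only [Pi.zero_apply, inner_zero_left, add_zero, coe_parCylOpens] using h

/-- **The class of Theorem 1.1 is stable under averaging the pressure about the axis, and the
averaged pressure is axially symmetric**: for `(v, q)` in the standing class of §3 (distributional
Navier–Stokes in `Q`, `v ∈ L₃(Q)`, `q ∈ L_{3/2}(Q)`, `v` axially symmetric), `(v, q̄)` is in the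
same class. [cite: SereginSverak2009, Thm 1.1 (arXiv p. 3) and Thm 3.1 (p. 9)] -/
theorem isAxisymmetricLocalSolution_rotAverage
    {u : ℝ → EuclideanSpace ℝ (Fin 3) → EuclideanSpace ℝ (Fin 3)}
    {p : ℝ → EuclideanSpace ℝ (Fin 3) → ℝ} (hsol : IsAxisymmetricLocalSolution u p) :
    IsAxisymmetricLocalSolution u
      (fun t x => (2 * Real.pi)⁻¹ * ∫ θ in (0 : ℝ)..2 * Real.pi, p t (rotZ θ x)) :=
  ⟨isDistributionalNSSolutionOn_rotAverage hsol.distributional hsol.axisymmetric, hsol.velocity_L3,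
    lintegral_rotAverage_rpow_lt_top hsol.distributional.2.2.1 hsol.pressure_L32, hsol.axisymmetric⟩

/-! ### Discharge of the named fact -/

/-- **Seregin–Šverák 2009, Theorem 1.1 with the Type I rate (1.1) on the meridional part only —
DISCHARGE of the named fact `MeridionalTypeIRegularity`.** "Assume that `v ∈ L₃(Q(z₀, R))` is an
axially symmetric weak solution to the Navier–Stokes equations in `Q(z₀, R)` such that there exists
an associated pressure field `q ∈ L_{3/2}(Q(z₀, R))`. If, in addition, `v` satisfies (1.1)
[`|v̄| ≤ C⁎/√(t₀ - t)`, `v̄ = v_ϱ e_ϱ + v₃ e₃`], then `z₀` is a regular point of `v`" — at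
`z₀ = 0`, `R = 1`, under (r2). Proof: the azimuthal average `q̄` of `q` is again an associated
pressure field, in `L_{3/2}(Q)` and axially symmetric (`isAxisymmetricLocalSolution_rotAverage`,
`isAxisymmetricScalar_rotAverage`), so the pair `(v, q̄)` is an axially symmetric weak solution as
in Theorem 3.1, to which the tree's proof of the printed theorem
(`isRegularAtOrigin_of_meridionalTypeI`: Lemma 3.3 via Seregin 2020 (2.6), Lemma 3.5, Prop. 3.7,
§4 and KNSS 2009 Thm 5.3) applies. [cite: SereginSverak2009, Thm 1.1 (arXiv p. 3) with (1.1) (p. 2); §3 Thm 3.1, Lemmas 3.3, 3.5, Prop. 3.7, §4] -/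
theorem MeridionalTypeIRegularity_holds : MeridionalTypeIRegularity :=
  fun _ p hsol hr2 hmer =>
    isRegularAtOrigin_of_meridionalTypeI (isAxisymmetricLocalSolution_rotAverage hsol) hr2 hmer
      fun t _ => isAxisymmetricScalar_rotAverage (p t)

end SereginSverak2009

end Literature.Analysis.FluidPDE
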